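import Literature.Geometry.Kaehler.SiegelTorusThetaNullComponentsConjugate
import HarnessLib

/-!
# `θ_null` and `(∂θ)_null` on `𝔥_g` are the `Γ_g`-saturations of a single component:
# `θ_null = Γ_g · {ϑ[m₀](0,·) = 0}` (`m₀` even), `(∂θ)_null = Γ_g · {grad_z ϑ[m₀](0,·) = 0}` (`m₀` odd)

Layer `Literature/Geometry/Kaehler`, namespace `Literature.Geometry.Kaehler.ComplexTorus` (lane
`lit-hodgefound`, Layer A4, theta-divisor row A4-17; prover seat `lit-hodgefound-p23`, row «A4-17(y)»).
Sequel of `SiegelTorusThetaNullComponentsConjugate.lean` (any two components of the same parity are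
`Γ_g`-conjugate), `SiegelTorusThetaNullModular.lean` (`memThetaNull_moeb_iff`: `θ_null` is
`Γ_g`-invariant) and `SiegelTorusThetaGradientModular.lean` (`memGradThetaNull_moeb_iff`).

Sources followed (held texts). S. Grushevsky, R. Salvati Manni (2008) [held `paper:arxiv-math_0605160`
p0004, Definition 6 and the sentence after it]: "`θ_null := {τ ∈ 𝒜_g^{4,8} | ∃ m even, θ_m(τ) = 0}` … By
the above transformation formulae, we see that `θ_null` [is] well-defined on `𝒜_g`"; S. Grushevsky,
R. Salvati Manni (2009) [held `paper:arxiv-0805.4148` p0010 L37–L41]: "`(∂θ)_null` is the union of such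
projections over all odd `[ε,δ]`, but they are all conjugate under `Γ_g`". Precisely, on `𝔥_g`: the locus
`{Z | some even theta constant vanishes}` is the union of the `Γ_g`-translates of ANY ONE component
`{Z | ϑ[k₀/2; l₀/2](0, Z) = 0}` (`ᵗk₀l₀` even), e.g. of `{ϑ[0;0](0,·) = 0}`; likewise `(∂θ)_null` for the
gradient loci.

What is here (theorems only; no definition, no named fact, net debt `0`).

* **`setOf_memThetaNull_eq_iUnion_image`** (`θ_null = ⋃_{M ∈ Γ_g} M·{ϑ[k₀/2;l₀/2](0,·) = 0}` for any
  even `(k₀, l₀)`), **`setOf_memThetaNull_eq_iUnion_image_zero`** (the component `ϑ[0;0]`).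
* **`setOf_memGradThetaNull_eq_iUnion_image`** (`(∂θ)_null = ⋃_{M ∈ Γ_g} M·{grad ϑ[k₀/2;l₀/2](0,·) = 0}`
  for any odd `(k₀, l₀)`).
* Rider: **`not_memThetaNull_fin_one`** / `setOf_memThetaNull_fin_one_eq_empty` (`θ_null,1 = ∅`: no even
  Jacobi theta constant vanishes), `memThetaNull_diagonal_of_two_le` / `setOf_memThetaNull_nonempty_of_two_le`
  (`θ_null,g ≠ ∅` for `g ≥ 2`).

## References

* [GrushevskySalvatiManni2008] S. Grushevsky, R. Salvati Manni, *Jacobians with a vanishing theta-null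
  in genus 4*, Israel J. Math. 164 (2008), Definition 6 (p0004 of the held text).
* [GrushevskySalvatiManni2009HighMultiplicity] S. Grushevsky, R. Salvati Manni, *Singularities of the theta
  divisor at points of order two* (arXiv:0805.4148), p0010 L37–L41 of the held text.
* [Lange2023AbelianVarietiesComplex] H. Lange, *Abelian Varieties over the Complex Numbers* (2023),
  §3.1.3 Prop. 3.1.6, §3.3.3 Thm. 3.3.9.
* [WhittakerWatson1927] E. T. Whittaker, G. N. Watson, *A Course of Modern Analysis* (4th ed., 1927),
  §21.12, §21.41.
-/

noncomputable section

open scoped Manifold Topology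
open scoped Real
open Set Function Complex Matrix Filter
open Literature.Analysis.SpecialFunctions Literature.Analysis.Complex

namespace Literature.Geometry.Kaehler

namespace ComplexTorus

open Literature.NumberTheory.Automorphic (siegelUpperHalfSpace)
open Literature.NumberTheory.ModularForms.SiegelUpperHalfSpace (moeb denom)

variable {n : ℕ}

/-- **`θ_null ⊂ 𝔥_g` is the `Γ_g`-saturation of any one even component**: for `k₀, l₀ ∈ ℤ^g` with
`ᵗk₀l₀` even,
`{Z ∈ 𝔥_g | ∃ (k,l) even, ϑ[k/2;l/2](0,Z) = 0} = ⋃_{M ∈ Sp_{2g}(ℤ)} M · {Z ∈ 𝔥_g | ϑ[k₀/2;l₀/2](0,Z) = 0}`.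
[cite: GrushevskySalvatiManni2008, Definition 6 (p0004 of the held text)]
[cite: GrushevskySalvatiManni2009HighMultiplicity, p0010 L37–L41 of the held text] -/
theorem setOf_memThetaNull_eq_iUnion_image (k₀ l₀ : Fin n → ℤ) (h₀ : Even (k₀ ⬝ᵥ l₀)) :
    {Z | Z ∈ siegelUpperHalfSpace n ∧ MemThetaNull Z} =
      ⋃ M : Matrix.symplecticGroup (Fin n) ℤ,
        moeb ((M : Matrix (Fin n ⊕ Fin n) (Fin n ⊕ Fin n) ℤ).map ((↑) : ℤ → ℂ)) ''
          {Z | Z ∈ siegelUpperHalfSpace n ∧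
            riemannThetaChar (fun i ↦ (k₀ i : ℂ) / 2) (fun i ↦ (l₀ i : ℂ) / 2) Z 0 = 0} := by
  ext W
  simp only [Set.mem_setOf_eq, Set.mem_iUnion]
  constructor
  · rintro ⟨hW, k, l, hkl, hθ⟩
    obtain ⟨M, hM⟩ := exists_symplectic_thetaNullComponent_eq_image k₀ l₀ k l h₀ hkl
    refine ⟨M, ?_⟩
    rw [← hM]
    exact ⟨hW, hθ⟩
  · rintro ⟨M, Z, ⟨hZ, hθ⟩, rfl⟩
    exact ⟨moeb_intCast_mem M.2 hZ, (memThetaNull_moeb_iff M.2 hZ).2 ⟨k₀, l₀, h₀, hθ⟩⟩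

/-- **`θ_null = Γ_g · {ϑ[0;0](0,·) = 0}`** on `𝔥_g`. [cite: GrushevskySalvatiManni2008, Definition 6 (p0004 of the held text)] -/
theorem setOf_memThetaNull_eq_iUnion_image_zero :
    {Z | Z ∈ siegelUpperHalfSpace n ∧ MemThetaNull Z} =
      ⋃ M : Matrix.symplecticGroup (Fin n) ℤ,
        moeb ((M : Matrix (Fin n ⊕ Fin n) (Fin n ⊕ Fin n) ℤ).map ((↑) : ℤ → ℂ)) ''
          {Z | Z ∈ siegelUpperHalfSpace n ∧ riemannThetaChar 0 0 Z 0 = 0} := by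
  have h := setOf_memThetaNull_eq_iUnion_image (n := n) 0 0 (by simp)
  have h0 : (fun i : Fin n ↦ (((0 : Fin n → ℤ) i : ℤ) : ℂ) / 2) = 0 := by
    funext i
    simp
  rw [h0] at h
  exact h

/-- **`(∂θ)_null ⊂ 𝔥_g` is the `Γ_g`-saturation of any one odd gradient locus**: for `k₀, l₀ ∈ ℤ^g` with
`ᵗk₀l₀` odd,
`{Z ∈ 𝔥_g | ∃ (k,l) odd, grad_z ϑ[k/2;l/2](0,Z) = 0} = ⋃_{M ∈ Sp_{2g}(ℤ)} M · {Z ∈ 𝔥_g | grad_z ϑ[k₀/2;l₀/2](0,Z) = 0}`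
("`(∂θ)_null` is the union of such projections over all odd `[ε,δ]`, but they are all conjugate under
`Γ_g`"). [cite: GrushevskySalvatiManni2009HighMultiplicity, p0010 L37–L41 of the held text] -/
theorem setOf_memGradThetaNull_eq_iUnion_image (k₀ l₀ : Fin n → ℤ) (h₀ : Odd (k₀ ⬝ᵥ l₀)) :
    {Z | Z ∈ siegelUpperHalfSpace n ∧ MemGradThetaNull Z} =
      ⋃ M : Matrix.symplecticGroup (Fin n) ℤ,
        moeb ((M : Matrix (Fin n ⊕ Fin n) (Fin n ⊕ Fin n) ℤ).map ((↑) : ℤ → ℂ)) ''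
          {Z | Z ∈ siegelUpperHalfSpace n ∧ MemGradThetaNullAt k₀ l₀ Z} := by
  ext W
  simp only [Set.mem_setOf_eq, Set.mem_iUnion]
  constructor
  · rintro ⟨hW, k, l, hkl, hθ⟩
    obtain ⟨M, hM⟩ := exists_symplectic_gradThetaNullComponent_eq_image k₀ l₀ k l h₀ hkl
    refine ⟨M, ?_⟩
    rw [← hM]
    exact ⟨hW, hθ⟩
  · rintro ⟨M, Z, ⟨hZ, hθ⟩, rfl⟩
    exact ⟨moeb_intCast_mem M.2 hZ, (memGradThetaNull_moeb_iff M.2 hZ).2 ⟨k₀, l₀, h₀, hθ⟩⟩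

/-! ### Rider: `θ_null,1 = ∅`, `θ_null,g ≠ ∅` for `g ≥ 2` -/

section GenusOne

/-- **In genus one no even theta constant vanishes**: `θ_null,1 = ∅`, i.e. `¬ MemThetaNull Z` for every
`Z ∈ 𝔥₁` (the three even Jacobi theta constants `θ₀₀, θ₀₁, θ₁₀` have no zeros on `ℍ`; a `1 × 1` period
matrix is diagonal and `ϑ[k/2; l/2](0, diag τ) = 0 ↔ ∃ i, kᵢ, lᵢ odd`, the tree's
`riemannThetaChar_half_zero_diagonal_eq_zero_iff`). The odd analogue `(∂θ)_null,1 = ∅` is the tree's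
`not_memGradThetaNull_fin_one`. [cite: WhittakerWatson1927, §21.12 and §21.41 (Jacobi's `ϑ₁' = πϑ₂ϑ₃ϑ₄`)]
[cite: GrushevskySalvatiManni2008, Definition 6 (p0004 of the held text)] -/
theorem not_memThetaNull_fin_one {Z : Matrix (Fin 1) (Fin 1) ℂ} (hZ : Z ∈ siegelUpperHalfSpace 1) :
    ¬ MemThetaNull Z := by
  rintro ⟨k, l, hkl, hθ⟩
  have hdiag : Z = Matrix.diagonal fun _ ↦ Z 0 0 := by
    ext i j
    rw [Subsingleton.elim i 0, Subsingleton.elim j 0, Matrix.diagonal_apply_eq]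
  have hτ : ∀ i : Fin 1, 0 < (Z 0 0).im := fun _ ↦ by
    have h := hZ.2.diag_pos (i := 0)
    rwa [Matrix.map_apply] at h
  rw [hdiag, riemannThetaChar_half_zero_diagonal_eq_zero_iff _ hτ] at hθ
  obtain ⟨i, hk, hl⟩ := hθ
  rw [Subsingleton.elim i 0] at hk hl
  have hodd : Odd (k ⬝ᵥ l) := by
    rw [show k ⬝ᵥ l = k 0 * l 0 from by simp [dotProduct]]
    exact hk.mul hl
  exact (Int.not_even_iff_odd.2 hodd) hkl

/-- **`θ_null,1 = ∅`** as a set. [cite: WhittakerWatson1927, §21.12 and §21.41]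
[cite: GrushevskySalvatiManni2008, Definition 6 (p0004 of the held text)] -/
theorem setOf_memThetaNull_fin_one_eq_empty :
    {Z : Matrix (Fin 1) (Fin 1) ℂ | Z ∈ siegelUpperHalfSpace 1 ∧ MemThetaNull Z} = ∅ :=
  Set.eq_empty_of_forall_notMem fun _ h ↦ not_memThetaNull_fin_one h.1 h.2

/-- **`θ_null,g ≠ ∅` for `g ≥ 2`**: a diagonal period matrix `diag(τ₁, …, τ_g)` lies on `θ_null` — the
even characteristic `k = l = e₀ + e₁` (two (odd, odd) coordinate pairs, `ᵗkl = 2`) has vanishing theta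
constant by the product formula (`riemannThetaChar_half_zero_diagonal_eq_zero_iff`); cf. the tree's
`memThetaNull_blockDiag` ("the resulting abelian variety has a vanishing thetanull").
[cite: GrushevskySalvatiManni2008, p0007 of the held text] [cite: WhittakerWatson1927, §21.12] -/
theorem memThetaNull_diagonal_of_two_le (hn : 2 ≤ n) (τ : Fin n → ℂ) (hτ : ∀ i, 0 < (τ i).im) :
    MemThetaNull (Matrix.diagonal τ) := by
  set i₀ : Fin n := ⟨0, by omega⟩ with hi₀
  set i₁ : Fin n := ⟨1, by omega⟩ with hi₁
  have h01 : i₀ ≠ i₁ := by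
    rw [hi₀, hi₁, Ne, Fin.ext_iff]
    exact Nat.zero_ne_one
  set k : Fin n → ℤ := fun i ↦ if i = i₀ ∨ i = i₁ then 1 else 0 with hk
  have hodd : ∀ m, Odd (k m) ↔ m = i₀ ∨ m = i₁ := fun m ↦ by
    by_cases hm : m = i₀ ∨ m = i₁
    · simp only [hk, if_pos hm, odd_one, true_iff]
      exact hm
    · simp only [hk, if_neg hm, Int.not_odd_zero, false_iff]
      exact hm
  refine ⟨k, k, ?_, (riemannThetaChar_half_zero_diagonal_eq_zero_iff τ hτ k k).2
    ⟨i₀, (hodd i₀).2 (Or.inl rfl), (hodd i₀).2 (Or.inl rfl)⟩⟩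
  rw [even_dotProduct_iff_even_card_oddSupport]
  have hS : (Finset.univ.filter fun m ↦ Odd (k m) ∧ Odd (k m)) = {i₀, i₁} := by
    ext m
    simp only [Finset.mem_filter, Finset.mem_univ, true_and, and_self, Finset.mem_insert,
      Finset.mem_singleton]
    exact hodd m
  rw [hS, Finset.card_pair h01]
  exact even_two

/-- **`θ_null,g ≠ ∅` for `g ≥ 2`**, in the set form: the diagonal point `i·1_g` lies in `θ_null,g`.
[cite: GrushevskySalvatiManni2008, p0007 of the held text] -/
theorem setOf_memThetaNull_nonempty_of_two_le (hn : 2 ≤ n) :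
    {Z : Matrix (Fin n) (Fin n) ℂ | Z ∈ siegelUpperHalfSpace n ∧ MemThetaNull Z}.Nonempty :=
  ⟨Matrix.diagonal fun _ ↦ I, diagonal_mem_siegelUpperHalfSpace _ fun _ ↦ by simp,
    memThetaNull_diagonal_of_two_le hn _ fun _ ↦ by simp⟩

end GenusOne

end ComplexTorus

end Literature.Geometry.Kaehler

end
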